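import Mathlib
import Summits.NavierStokesRegularity.NavierStokesRegularity.Theorems.FilamentSkeletonRssStadiumStepProfile

/-!
# Route `FilamentSkeletonRss` · child crux `TangentSkeletonNearStraightL` (stmt-NavierStokesRegularity-23320) · registered line
# `child_tangent_analytic_strip_L` (b0b56c52900dd90a), stub `stub_stripPropagation` — brick: POSITION-SPLIT PAIR PROFILES AND THEIR DOUBLE MEANS

The hybrid pair bound of the quarter-width descent (evidence `CORNER-QUARTER-BLUEPRINT-leafhand-15-g0.md` v3 on 23320): on a sloped chord
`r ↦ ζ + r(z − ζ)` the pairs with BOTH parameters in the near-target part `(θ, 1]` (large Cauchy radius) get the second-order bound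
`‖a(r)·a(r′) − 1‖ ≤ (3/2)(G(r) − G(r′))²` (`G` an antiderivative of the Lipschitz modulus `‖s‖·M/d` along the chord,
`Theorems.StadiumChordVariance.norm_sum_mul_sub_one_le`), all other pairs a constant first-order bound `C` (`Theorems.StadiumPairPositivity`).
The resulting profile `φ(r,r′) = if θ < r ∧ θ < r′ then (3/2)(G r − G r′)² else C` is a product-region step/continuous hybrid; this file
supplies exactly what the integrable pair-averaging lemmas (`Theorems.StadiumPairAveraging(Integrable)`) ask for:
* `intervalIntegral_of_eqOn_Ioc'` — a function equal on `Ioc a b` to an interval-integrable one is interval-integrable with the same integral;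
* `split_inner_eq` — the inner integrals (`= C` for `r ≤ θ`; `= θC + (3/2)((1−θ)G(r)² − 2G(r)·∫_θ¹G + ∫_θ¹G²)` for `θ < r`);
* `split_double_mean_eq` — integrability facts and the SEPARABLE closed form
  `∫₀¹∫₀¹ φ = θ(2−θ)·C + 3·((1−θ)·∫_θ¹ G² − (∫_θ¹ G)²)`.
Certified-form corner number (hand's census `diag/split_pos.out`): with this split the right descent keeps margin `+0.086` (`Rb = 1/2`).
HONEST FRAMING: elementary real analysis for a plan about a HYPOTHETICAL filament skeleton on the NEGATIVE side of a MODEL route; the stub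
`stub_stripPropagation` is NOT closed by this file; nothing here bears on Navier–Stokes regularity or blow-up.  `--supports stmt-NavierStokesRegularity-23320`.
-/

set_option linter.dupNamespace false

noncomputable section

namespace Summit.NavierStokesRegularity.NavierStokesRegularity.Theorems.StadiumSplitProfile

open Set MeasureTheory
open Summit.NavierStokesRegularity.NavierStokesRegularity.Theorems.StadiumStepProfile

/-- A function equal on `Ioc a b` (`a ≤ b`) to an interval-integrable `g` is interval-integrable with the same integral. [folklore] -/
theorem intervalIntegral_of_eqOn_Ioc' {f g : ℝ → ℝ} {a b : ℝ} (hab : a ≤ b) (hg : IntervalIntegrable g volume a b)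
    (h : ∀ x ∈ Ioc a b, f x = g x) :
    IntervalIntegrable f volume a b ∧ ∫ x in a..b, f x = ∫ x in a..b, g x := by
  have hae : ∀ᵐ x ∂volume, x ∈ Set.uIoc a b → f x = g x := by
    refine Filter.Eventually.of_forall fun x hx => ?_
    rw [uIoc_of_le hab] at hx
    exact h x hx
  have hint : IntervalIntegrable f volume a b := by
    rw [intervalIntegrable_iff] at hg ⊢
    refine hg.congr_fun_ae ?_
    rw [Filter.EventuallyEq, ae_restrict_iff' measurableSet_uIoc]
    exact hae.mono fun x hx hx' => (hx hx').symm
  exact ⟨hint, intervalIntegral.integral_congr_ae hae⟩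

/-- **The near-part second-order integral**: `∫_θ¹ (3/2)(G r − G r′)² dr′ = (3/2)((1−θ)G(r)² − 2G(r)∫_θ¹G + ∫_θ¹G²)`. [folklore] -/
theorem near_integral_eq {G : ℝ → ℝ} (hG : Continuous G) (θ r : ℝ) :
    ∫ r' in θ..1, (3 / 2 : ℝ) * (G r - G r') ^ 2 =
      (3 / 2 : ℝ) * ((1 - θ) * G r ^ 2 - 2 * G r * (∫ r' in θ..1, G r') + ∫ r' in θ..1, G r' ^ 2) := by
  have hGi : IntervalIntegrable G volume θ 1 := hG.intervalIntegrable _ _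
  have hG2i : IntervalIntegrable (fun r' => G r' ^ 2) volume θ 1 := (hG.pow 2).intervalIntegrable _ _
  have h1 : (fun r' => (3 / 2 : ℝ) * (G r - G r') ^ 2) =
      fun r' => (3 / 2 : ℝ) * ((G r ^ 2 - (2 * G r) * G r') + G r' ^ 2) := by
    funext r'; ring
  rw [h1, intervalIntegral.integral_const_mul,
    intervalIntegral.integral_add (intervalIntegrable_const.sub (hGi.const_mul _)) hG2i,
    intervalIntegral.integral_sub intervalIntegrable_const (hGi.const_mul _),
    intervalIntegral.integral_const, intervalIntegral.integral_const_mul, smul_eq_mul]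

/-- **Inner integrals of the position-split profile.**  For `0 ≤ θ ≤ 1`, `G` continuous, `C` a constant and
`φ(r,r′) = if θ < r ∧ θ < r′ then (3/2)(G r − G r′)² else C`: for every `r`, `r′ ↦ φ(r,r′)` is interval-integrable on `[0,1]`, with
`∫₀¹ φ(r,·) = C` if `r ≤ θ` and `= θC + (3/2)((1−θ)G(r)² − 2G(r)∫_θ¹G + ∫_θ¹G²)` if `θ < r`. [folklore] -/
theorem split_inner_eq {θ C : ℝ} (hθ0 : 0 ≤ θ) (hθ1 : θ ≤ 1) {G : ℝ → ℝ} (hG : Continuous G) (r : ℝ) :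
    IntervalIntegrable (fun r' : ℝ => if θ < r ∧ θ < r' then (3 / 2 : ℝ) * (G r - G r') ^ 2 else C) volume 0 1 ∧
    ((r ≤ θ → ∫ r' in (0:ℝ)..1, (if θ < r ∧ θ < r' then (3 / 2 : ℝ) * (G r - G r') ^ 2 else C) = C) ∧
     (θ < r → ∫ r' in (0:ℝ)..1, (if θ < r ∧ θ < r' then (3 / 2 : ℝ) * (G r - G r') ^ 2 else C) =
        θ * C + (3 / 2 : ℝ) * ((1 - θ) * G r ^ 2 - 2 * G r * (∫ r' in θ..1, G r') + ∫ r' in θ..1, G r' ^ 2))) := by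
  set f : ℝ → ℝ := fun r' => if θ < r ∧ θ < r' then (3 / 2 : ℝ) * (G r - G r') ^ 2 else C with hf
  rcases le_or_gt r θ with hr | hr
  · -- `r ≤ θ`: the profile is the constant `C`
    have hall : ∀ x ∈ Ioc (0:ℝ) 1, f x = C := fun x _ => by
      simp only [hf]; rw [if_neg]; exact fun h => absurd h.1 (not_lt.2 hr)
    have h := intervalIntegral_of_eqOn_Ioc (f := f) zero_le_one hall
    refine ⟨h.1, fun _ => ?_, fun h' => absurd h' (not_lt.2 hr)⟩
    rw [h.2]; ring
  · -- `θ < r`: constant on `(0, θ]`, second order on `(θ, 1]`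
    have h1 := intervalIntegral_of_eqOn_Ioc (f := f) (a := 0) (b := θ) (c := C) hθ0 fun x hx => by
      simp only [hf]; rw [if_neg]; exact fun h => absurd h.2 (not_lt.2 hx.2)
    have hcont : Continuous fun r' => (3 / 2 : ℝ) * (G r - G r') ^ 2 := by fun_prop
    have h2 := intervalIntegral_of_eqOn_Ioc' (f := f) (g := fun r' => (3 / 2 : ℝ) * (G r - G r') ^ 2) hθ1
      (hcont.intervalIntegrable _ _) fun x hx => by
        simp only [hf]; rw [if_pos ⟨hr, hx.1⟩]
    refine ⟨h1.1.trans h2.1, fun h' => absurd hr (not_lt.2 h'), fun _ => ?_⟩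
    rw [← intervalIntegral.integral_add_adjacent_intervals h1.1 h2.1, h1.2, h2.2, near_integral_eq hG θ r]
    ring

/-- **Double mean of the position-split profile** (separable closed form).  For `0 ≤ θ ≤ 1`, `G` continuous, `C` constant and
`φ(r,r′) = if θ < r ∧ θ < r′ then (3/2)(G r − G r′)² else C`: the integrability facts of the integrable pair-averaging lemmas hold and
`∫₀¹∫₀¹ φ = θ(2−θ)·C + 3·((1−θ)·∫_θ¹ G² − (∫_θ¹ G)²)`. [folklore] -/
theorem split_double_mean_eq {θ C : ℝ} (hθ0 : 0 ≤ θ) (hθ1 : θ ≤ 1) {G : ℝ → ℝ} (hG : Continuous G) :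
    (∀ r : ℝ, IntervalIntegrable
      (fun r' : ℝ => if θ < r ∧ θ < r' then (3 / 2 : ℝ) * (G r - G r') ^ 2 else C) volume 0 1) ∧
    IntervalIntegrable (fun r : ℝ => ∫ r' in (0:ℝ)..1,
      (if θ < r ∧ θ < r' then (3 / 2 : ℝ) * (G r - G r') ^ 2 else C)) volume 0 1 ∧
    ∫ r in (0:ℝ)..1, ∫ r' in (0:ℝ)..1, (if θ < r ∧ θ < r' then (3 / 2 : ℝ) * (G r - G r') ^ 2 else C) =
      θ * (2 - θ) * C + 3 * ((1 - θ) * (∫ r in θ..1, G r ^ 2) - (∫ r in θ..1, G r) ^ 2) := by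
  set A : ℝ := ∫ r' in θ..1, G r' with hA
  set B : ℝ := ∫ r' in θ..1, G r' ^ 2 with hB
  set Φ : ℝ → ℝ := fun r => ∫ r' in (0:ℝ)..1, (if θ < r ∧ θ < r' then (3 / 2 : ℝ) * (G r - G r') ^ 2 else C) with hΦ
  have hinner := fun r => split_inner_eq (C := C) hθ0 hθ1 hG r
  -- `Φ` is `C` on `(0, θ]` and the continuous near-expression on `(θ, 1]`
  set g : ℝ → ℝ := fun r => θ * C + (3 / 2 : ℝ) * ((1 - θ) * G r ^ 2 - 2 * G r * A + B) with hg
  have hgc : Continuous g := by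
    simp only [hg]; fun_prop
  have h1 := intervalIntegral_of_eqOn_Ioc (f := Φ) (a := 0) (b := θ) (c := C) hθ0 fun x hx => (hinner x).2.1 hx.2
  have h2 := intervalIntegral_of_eqOn_Ioc' (f := Φ) (g := g) hθ1 (hgc.intervalIntegrable _ _) fun x hx =>
    (hinner x).2.2 hx.1
  refine ⟨fun r => (hinner r).1, h1.1.trans h2.1, ?_⟩
  have hsplit : ∫ r in (0:ℝ)..1, Φ r = (∫ r in (0:ℝ)..θ, Φ r) + ∫ r in θ..1, Φ r :=
    (intervalIntegral.integral_add_adjacent_intervals h1.1 h2.1).symm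
  rw [hsplit, h1.2, h2.2]
  -- `∫_θ¹ g = (1−θ)θC + (3/2)((1−θ)B − 2A·A + (1−θ)B)`
  have hGi : IntervalIntegrable G volume θ 1 := hG.intervalIntegrable _ _
  have hG2i : IntervalIntegrable (fun r => G r ^ 2) volume θ 1 := (hG.pow 2).intervalIntegrable _ _
  have hg_int : ∫ r in θ..1, g r = (1 - θ) * (θ * C) + (3 / 2 : ℝ) * ((1 - θ) * B - 2 * A * A + (1 - θ) * B) := by
    have e1 : g = fun r => (θ * C + (3 / 2 : ℝ) * B) + (((3 / 2 : ℝ) * (1 - θ)) * G r ^ 2 - ((3 : ℝ) * A) * G r) := by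
      funext r; simp only [hg]; ring
    rw [e1, intervalIntegral.integral_add intervalIntegrable_const ((hG2i.const_mul _).sub (hGi.const_mul _)),
      intervalIntegral.integral_const, intervalIntegral.integral_sub (hG2i.const_mul _) (hGi.const_mul _),
      intervalIntegral.integral_const_mul, intervalIntegral.integral_const_mul, smul_eq_mul]
    ring
  rw [hg_int]
  ring

end Summit.NavierStokesRegularity.NavierStokesRegularity.Theorems.StadiumSplitProfile

end
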